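import Literature.MathematicalPhysics.QuantumFieldTheory.Balaban1983to89.B9Eq326G1kSliceGradRowClosed
import Literature.MathematicalPhysics.QuantumFieldTheory.Balaban1983to89.Beta.RemainderHasMajQkTower

/-!
# T. Bałaban, *Propagators for lattice gauge theories in a background field*, Commun. Math. Phys. **99** (1985) 389–434
# [Balaban1985BackgroundPropagators] Thm 3.3 (3.42) pp. 397–399 (the covariant-derivative line) with [Balaban1985Variational] (129) p. 297, (190) p. 308:
# **THE SLICE-GRADIENT LINE's `hEG0` LETTER OF ROW (D4)'s NODE D ON NE9's TOWER — the NE9 OWNER's (E2)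
# `B9Eq326G1kSliceGradRowClosed.exists_local_gradLetter_G1k` (the row of `D_U(G₁,k f)_μ` on bonds) AS
# `HasMaj S^{fine bonds, Π∘b₋}_m S^{fine bonds, Π∘b₊}_m ((e ∘ D_U∘(·)_μ∘G₁,k ∘ e⁻¹)↾ℝ) (B·e^{−δ·d_∞})`, `∃ (α₁, B, δ)` BEFORE THE HEIGHT, EVERY COMPONENT `μ`**

CITATION HEADER (lean-in-tree rule 2026-08-18).  Sources: [Balaban1985BackgroundPropagators] (B9 = [5] of [15]; held `paper:balaban1985-cmp99-background-propagators`,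
journal page = PDF page + 388): (3.3) p. 391 (the covariant derivative `D_U` on bond functions ∕ its slices), Thm 3.1 (3.42) p. 397 (the lines of (3.42): value,
covariant derivative `∇_U`, covariant Laplacian, Hölder quotient — the display's OCR in the held text layer is degraded; shape as described in the headers of
(K64) ∕ (E2)), Thm 3.3 p. 399 (*«the operator G(U) (a = 1) satisfies the inequalities (3.42)–(3.47), with G′(U) replaced by G(U) and λ replaced by a function
J defined at bonds»*), (3.26) p. 395, Thm 3.11 p. 416; [Balaban1985Variational] (B11 = [15]; `paper:balaban1985-cmp102-variational-background`, journal page =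
PDF page + 276): p. 297 after (128)–(129) (*«… and satisfies the bound (3.133) [5] with the additional inequality for the covariant Laplace operator»*), (182)
p. 307, (190) p. 308; [Balaban1984PropagatorsII] (B6) (2.51)–(2.52) p. 232.  [15] pp. 297, 306–308 and [5] pp. 391, 397–399 re-read this generation in the
held text layers.

WHY THIS FILE (audit cell `pub-balaban`, BINDER row (D4), OWNER lineage `b2b-balaban-beta-an4`, gen 111; recipe `HOME/b2b-balaban-beta-an4/g111/Y9-RECIPE.md`;
the twin of «Y6» `Beta.RemainderHasMajDivG1kTower` for the GRADIENT line).  NODE D's (190) runs over every LINE of (3.42) ∕ (190).  «V81»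
`Beta.RemainderOriginLeftEntry.ineq190_origin_leftEntry_of_two_letters` assembles any left entry `E∘(H₀ + G̃Δ⁽²⁾H₀)` from V79's letters plus ONE letter
`hEG0 : HasMaj b3 bE (E∘G₀) (B_E e^{−δ₁d})`.  For the SLICE-GRADIENT line on NE9's tower, `E := D_U∘(·)_μ` — the `μ`-slice of a bond field (a site field)
followed by `B11Eq103H1Complex.covDerivL2K ℂ c₀ (η⁻¹) (adTransportW φ U)` (fine bonds → fine sites → fine bonds) — the NE9 OWNER's END (E2)
`B9Eq326G1kSliceGradRowClosed.exists_local_gradLetter_G1k` (t4-ne9-p1 g96: (K64)'s Woodbury assembly post-composed by the slice derivative, outer letter (VGRC),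
`HU` inhabited by the OWNER's (GRC)) proves the pointwise row `‖(D_U(G₁,k f)_μ)(b)‖ ≤ B·e^{−δ·d_m(Π b₊, v)}·F` for `f` supported over the big block `Π⁻¹(v)` of
the fine bonds (blocked by `b₋ = bpos`), `∃ (α₁, B, δ)` BEFORE the height, every `μ`.  THIS FILE is the junction, token for token — «Y4b»'s two-carrier lemma
`Beta.RemainderHasMajQkTower.hasMaj_supSize_of_local₂` at `X := Bond d (towerP L m (n+1))` blocked by `Π ∘ bpos` (source) and `X′ := Bond d (towerP L m (n+1))`
blocked by `Π ∘ btgt` (target — (E2)'s decay is keyed on `b₊`; no constant is lost).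
* **`exists_hasMaj_sliceGradG1k_tower_sup`** — `∃ α₁ B δ, 0 < α₁ ∧ 0 ≤ B ∧ 0 < δ ∧ ∀ ⟨(E2)'s block = (K64)'s⟩ (η₀ L₀ M₀ R) (H) (μ : Fin d),
  HasMaj S^{fine bonds, b₋}_m S^{fine bonds, b₊}_m ((e ∘ (D_U ∘ e_S⁻¹ ∘ (·)_μ ∘ e ∘ G1k … hpos) ∘ e⁻¹)↾ℝ) (fun y v ↦ B·e^{−δ·tdist m (toSite y) (toSite v)})` —
  EXACTLY the `hEG0` binder of «V81»'s tower instance for `E = D_U∘(·)_μ` (to be typed: «Y7»'s pattern with this left entry, target sizes on `b₊`-blocks).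

HONEST SCOPE.  [folklore] ONE application of the two-carrier socket lemma to the NE9 OWNER's END, nothing restated; NO estimate of [5] is proved here; the
constants are the NE9 crew's (crude, height-free), NOT print's; the statement is about the cell's MODEL (the binders under the `∀`: window on bonds, plaquettes,
bond gradients; level averages `U1`-valued with display `αU` in the summable regime; contractive transporters; positivity `hpos′` ∕ `hpos` DISPLAYED) — «NE9 ⇐
the named binders» travels with it; nothing identifies Bałaban's step-`k` objects with tree terms (NODE O FROZEN (0)); the (117) operator bound and the words
`𝔓_k` ∕ `H₁,k` of [15] are NOT here.  Row (D4) class UNCHANGED (instance 0∕1; D4 DISCHARGE NO DATE); NOT B12 Thm 2, NOT BetaPertH, NOT continuum, NOT Clay.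
HONEST DEPENDENCY (cell line): continuum YM on T⁴ ⇐ BetaPertH ∧ nine spine estimates (0/9 proved); BetaPertH ⇐ (D1) ∧ (D4) ∧ CAP+tail; G-an2-4 gates asym,
D1 and NE2/3/4.  NEW file importing (E2) and «Y4b»; nothing modified; 0 `def`; standard axioms; no `sorry`.  Net new unproved facts: 0.
-/

noncomputable section

open scoped BigOperators InnerProductSpace ComplexConjugate

namespace Literature.MathematicalPhysics.QuantumFieldTheory.Balaban1983to89.Beta.RemainderHasMajSliceGradG1kTower

open B11SectG B11SupSize190
open B4Sect5Torus (TSite tdist tdist_nonneg)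
open B5TorusCover (UT)
open B9Thm34Ext (toB6)
open B9Thm37GlueTorus (torusGeom)
open B9SectCLatticeCarrier (Bond bpos btgt unshift)
open B9Eq311L2Pairing (WL2)
open B9Eq319QprimeTorus (blockCoord)
open B9Eq315QTower (towerP UlevOf)
open B9Eq315QTorus (perCfg cornerSite)
open B9Eq316TowerFlatIsOneStep (siteCast towerP_eq_fineP_pow)
open B7Prop1Explicit (U1 Wcx boxVec)
open B9Eq310DeltaPrime (plaqHolU)
open B9Eq310HessianOperator (adTransportW)
open B11Eq103H1Complex (SiteL2K BondL2K covDerivL2K)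
open B9Eq326OperatorTower (laplaceAk G1k)
open B9Eq324DeltaPrimeATower (laplacePrimeAk)
open B9Eq326G1kSliceGradRowClosed (exists_local_gradLetter_G1k)
open Beta.RemainderHasMajQkTower (hasMaj_supSize_of_local₂)

/-! ### Torus bookkeeping (private) -/

section Aux

variable {d : ℕ} {m : Fin d → ℕ}

/-- `ofSite a = y ↔ a = toSite y`. [folklore] -/
private theorem ofSite_eq_iff (a : TSite d m) (y : UT m) : UT.ofSite m a = y ↔ a = UT.toSite m y := by
  constructor
  · rintro rfl; rfl
  · rintro rfl; rfl

/-- The boxes of the fine-bond big-block map are its fibres. [folklore] -/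
private theorem mem_boxFine_iff {L : ℕ} [NeZero L] {n : ℕ} (y : UT m) (b : Bond d (towerP L m (n + 1))) :
    b ∈ (Finset.univ.filter fun b : Bond d (towerP L m (n + 1)) =>
        blockCoord (L ^ (n + 1)) m (siteCast (towerP_eq_fineP_pow L m (n + 1)) (bpos b)) = UT.toSite m y) ↔
      UT.ofSite m (blockCoord (L ^ (n + 1)) m (siteCast (towerP_eq_fineP_pow L m (n + 1)) (bpos b))) = y := by
  rw [Finset.mem_filter, ofSite_eq_iff]
  simp

/-- The boxes of the fine-bond big-block map through `btgt` are its fibres. [folklore] -/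
private theorem mem_boxFineTgt_iff {L : ℕ} [NeZero L] {n : ℕ} (y : UT m) (b : Bond d (towerP L m (n + 1))) :
    b ∈ (Finset.univ.filter fun b : Bond d (towerP L m (n + 1)) =>
        blockCoord (L ^ (n + 1)) m (siteCast (towerP_eq_fineP_pow L m (n + 1)) (btgt b)) = UT.toSite m y) ↔
      UT.ofSite m (blockCoord (L ^ (n + 1)) m (siteCast (towerP_eq_fineP_pow L m (n + 1)) (btgt b))) = y := by
  rw [Finset.mem_filter, ofSite_eq_iff]
  simp

end Aux

/-! ## The slice-gradient line's `hEG0` letter on NE9's tower: (E2) in the (190) sup currency, `∃ (α₁, B, δ)` first, every `μ` -/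

section Tower

variable {d : ℕ} (hd : 1 ≤ d) (L : ℕ) [NeZero L] (hL : 1 ≤ L) (hL3 : 3 ≤ L)
  {𝔸 : Type*} [NormedRing 𝔸] [NormedAlgebra ℂ 𝔸] [CompleteSpace 𝔸] [NormOneClass 𝔸] [StarRing 𝔸] [NormedStarGroup 𝔸] [StarModule ℂ 𝔸]
  {W : Type} [NormedAddCommGroup W] [InnerProductSpace ℂ W] [FiniteDimensional ℂ W] (φ : W ≃ₗ[ℂ] 𝔸)
  {Mφ Mφ' : ℝ} (hMφ : 0 ≤ Mφ) (hMφ' : 0 ≤ Mφ') (hφ : ∀ w, ‖φ w‖ ≤ Mφ * ‖w‖) (hφ' : ∀ X, ‖φ.symm X‖ ≤ Mφ' * ‖X‖) (hstar : ∀ X : 𝔸, ‖star X‖ ≤ ‖X‖)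
  {a : ℝ} (ha : 0 < a) {a' : ℝ} (ha' : 0 < a') {ϱ : ℝ} (hϱ0 : 0 ≤ ϱ) (hϱ1 : ϱ < 1)
  (τ : 𝔸 →ₗ[ℂ] ℂ) {Cτ : ℝ} (hτ : ∀ X, ‖τ X‖ ≤ Cτ * ‖X‖) (hCτ : 0 ≤ Cτ) {Mτ : ℝ} (hτm : ∀ X Y : 𝔸, ‖τ (X * Y)‖ ≤ Mτ * ‖X‖ * ‖Y‖) (hMτ : 0 ≤ Mτ)
  {ρw : ℝ} (hρw : 0 ≤ ρw)
  (hτ₁ : ∀ X : 𝔸, τ (star X) = conj (τ X)) (hτ₂ : ∀ X Y : 𝔸, τ (X * Y) = τ (Y * X)) (hφτ : ∀ X Y : 𝔸, ⟪φ.symm X, φ.symm Y⟫_ℂ = τ (star X * Y))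
  (AQ : ℝ)

include hd hL hL3 hMφ hMφ' hφ hφ' hstar ha ha' hϱ0 hϱ1 hτ hCτ hτm hMτ hρw hτ₁ hτ₂ hφτ in
/-- **THE SLICE-GRADIENT LINE's `hEG0` LETTER ON NE9's TOWER — (E2) `exists_local_gradLetter_G1k` AS `HasMaj S^{fine bonds, b₋}_m S^{fine bonds, b₊}_m
((e ∘ D_U∘(·)_μ∘G₁,k ∘ e⁻¹)↾ℝ) (B·e^{−δ·d_∞})`, `∃ (α₁, B, δ)` BEFORE THE HEIGHT, EVERY `μ`** ([5] Thm 3.3: the covariant-derivative line of (3.42) for the bond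
Green's function; [15] p. 297).  Binders = (E2)'s (= (K64)'s), token for token, minus its source datum `(v, f, F)` and output bond `b` (quantified inside
the majorant), plus an arbitrary torus geometry `(η₀, L₀, M₀, R, H)` and the component `μ`; source = the fine bonds blocked by `Π ∘ bpos`, target = the fine
bonds blocked by `Π ∘ btgt`, `Π = blockCoord (L^(n+1)) m ∘ siteCast`, both sup sizes of (190) over the torus of blocks `T_m`.  One application of
`Beta.RemainderHasMajQkTower.hasMaj_supSize_of_local₂` to (E2)'s first reading; the operators `covDerivL2K ℂ c₀ (η⁻¹) (adTransportW φ U)`, `G1k … hpos` and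
the constants are the NE9 crew's, untouched; the slice `(·)_μ` is `LinearMap.pi (fun y ↦ LinearMap.proj (y, μ))`.
[cite: Balaban1985BackgroundPropagators, (3.3) p.391, Thm 3.1 (3.42) p.397, Thm 3.3 p.399, (3.26) p.395, Thm 3.11 p.416]
[cite: Balaban1985Variational, p.297 after (128), (190) p.308] [cite: Balaban1984PropagatorsII, (2.51)–(2.52) p.232] -/
theorem exists_hasMaj_sliceGradG1k_tower_sup :
    ∃ α₁ B δ : ℝ, 0 < α₁ ∧ 0 ≤ B ∧ 0 < δ ∧
      ∀ (n : ℕ) (η : ℝ) (_hηL : η * (L : ℝ) ^ (n + 1) = 1) (c₀ c₁ : ℝ) [Fact (0 < c₀)] [Fact (0 < c₁)]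
        (_hw : c₀ * ((L : ℝ) ^ (n + 1)) ^ d = c₁) (_hρ : |η| ^ d / c₀ ≤ ρw) (m : Fin d → ℕ) [∀ i, NeZero (m i)] (_hm : ∀ i, 1 ≤ m i)
        (U : Bond d (towerP L m (n + 1)) → 𝔸ˣ) (αU : ℕ → ℝ) (_hα0 : ∀ j, 0 ≤ αU j) (hα1 : ∀ j, αU j ≤ 1 / 64)
        (hU1 : ∀ (j : ℕ) (x : B7Prop1Explicit.Site d) (k : Fin d), perCfg (towerP L m (j + 1)) (UlevOf L m (n + 1) U j) x k ∈ U1 𝔸)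
        (hreg : ∀ (j : ℕ) (y : TSite d (towerP L m j)) (k : Fin d) (ρ' : Fin d → Fin L),
          ‖((Wcx L (perCfg (towerP L m (j + 1)) (UlevOf L m (n + 1) U j)) (cornerSite L y) k (boxVec L ρ') : 𝔸ˣ) : 𝔸) - 1‖ ≤ αU j)
        (εU : ℕ → ℝ) (_hεU : ∀ j, 0 ≤ εU j) (_hUε : ∀ (j : ℕ) (b : Bond d (towerP L m (j + 1))), ‖(UlevOf L m (n + 1) U j b : 𝔸) - 1‖ ≤ εU j)
        (_hLb : ∀ (j : ℕ) (b : Bond d (towerP L m (j + 1))), UlevOf L m (n + 1) U j b ∈ U1 𝔸)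
        (α : ℝ) (_hα : 0 ≤ α) (_hαle : α ≤ α₁)
        (hUst : ∀ b, star (U b : 𝔸) = (((U b)⁻¹ : 𝔸ˣ) : 𝔸)) (_hUb : ∀ b, U b ∈ U1 𝔸) (_hUη : ∀ b, ‖(U b : 𝔸) - 1‖ ≤ α * η)
        (_hpl : ∀ p : B9SectCLatticeCarrier.Plaq d (towerP L m (n + 1)), ‖(plaqHolU U p : 𝔸) - 1‖ ≤ α * η ^ 2)
        (_hUgrad : ∀ (x : TSite d (towerP L m (n + 1))) (μ : Fin d), ‖(U (x, μ) : 𝔸) - U (unshift μ x, μ)‖ ≤ α * η ^ 2)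
        (_hRlev : ∀ (j : ℕ) (b : Bond d (towerP L m (j + 1))) (w : W), ‖adTransportW φ (UlevOf L m (n + 1) U j) b w‖ ≤ ‖w‖)
        (_hεg : ∀ j < n + 1, εU j ≤ α * ϱ ^ j) (_hAQ : ∑ j ∈ Finset.range (n + 1), αU j ≤ AQ)
        (hpos' : ∀ x : SiteL2K ℂ d (towerP L m (n + 1)) c₀ W, x ≠ 0 → 0 < RCLike.re ⟪x, laplacePrimeAk L m n φ η U a' (c₁ := c₁) x⟫_ℂ)
        (hpos : ∀ x : BondL2K ℂ d (towerP L m (n + 1)) c₀ W, x ≠ 0 →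
          0 < RCLike.re ⟪x, laplaceAk L m n φ η U hL αU hα1 hU1 hreg τ (c₀ := c₀) (c₁ := c₁) a x⟫_ℂ)
        (η₀ L₀ M₀ R : ℝ) (H : Prop) (μ : Fin d),
        HasMaj
          (supSize (toB6 (torusGeom m η₀ L₀ M₀) R H)
            (fun y => Finset.univ.filter fun b : Bond d (towerP L m (n + 1)) =>
              blockCoord (L ^ (n + 1)) m (siteCast (towerP_eq_fineP_pow L m (n + 1)) (bpos b)) = UT.toSite m y)
            (fun b => UT.ofSite m (blockCoord (L ^ (n + 1)) m (siteCast (towerP_eq_fineP_pow L m (n + 1)) (bpos b)))) :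
              BlockNorm (toB6 (torusGeom m η₀ L₀ M₀) R H) (Bond d (towerP L m (n + 1)) → W))
          (supSize (toB6 (torusGeom m η₀ L₀ M₀) R H)
            (fun y => Finset.univ.filter fun b : Bond d (towerP L m (n + 1)) =>
              blockCoord (L ^ (n + 1)) m (siteCast (towerP_eq_fineP_pow L m (n + 1)) (btgt b)) = UT.toSite m y)
            (fun b => UT.ofSite m (blockCoord (L ^ (n + 1)) m (siteCast (towerP_eq_fineP_pow L m (n + 1)) (btgt b)))) :
              BlockNorm (toB6 (torusGeom m η₀ L₀ M₀) R H) (Bond d (towerP L m (n + 1)) → W))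
          (((WL2.linearEquiv ℂ ℂ (fun _ : Bond d (towerP L m (n + 1)) => c₀) :
                BondL2K ℂ d (towerP L m (n + 1)) c₀ W ≃ₗ[ℂ] (Bond d (towerP L m (n + 1)) → W)).toLinearMap ∘ₗ
              (covDerivL2K ℂ c₀ ((η : ℂ))⁻¹ (adTransportW φ U) ∘ₗ
                (WL2.linearEquiv ℂ ℂ (fun _ : TSite d (towerP L m (n + 1)) => c₀) :
                  SiteL2K ℂ d (towerP L m (n + 1)) c₀ W ≃ₗ[ℂ] (TSite d (towerP L m (n + 1)) → W)).symm.toLinearMap ∘ₗ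
                (LinearMap.pi fun y : TSite d (towerP L m (n + 1)) =>
                  (LinearMap.proj ((y, μ) : Bond d (towerP L m (n + 1))) : (Bond d (towerP L m (n + 1)) → W) →ₗ[ℂ] W)) ∘ₗ
                (WL2.linearEquiv ℂ ℂ (fun _ : Bond d (towerP L m (n + 1)) => c₀) :
                  BondL2K ℂ d (towerP L m (n + 1)) c₀ W ≃ₗ[ℂ] (Bond d (towerP L m (n + 1)) → W)).toLinearMap ∘ₗ
                G1k L m n φ η U hL αU hα1 hU1 hreg τ (c₀ := c₀) (c₁ := c₁) hpos) ∘ₗ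
              (WL2.linearEquiv ℂ ℂ (fun _ : Bond d (towerP L m (n + 1)) => c₀) :
                BondL2K ℂ d (towerP L m (n + 1)) c₀ W ≃ₗ[ℂ] (Bond d (towerP L m (n + 1)) → W)).symm.toLinearMap).restrictScalars ℝ)
          (fun y v => B * Real.exp (-(δ * tdist m (UT.toSite m y) (UT.toSite m v)))) := by
  obtain ⟨α₁, B, δ, hα₁, hB, hδ, HK⟩ := exists_local_gradLetter_G1k hd L hL hL3 φ hMφ hMφ' hφ hφ' hstar ha ha' hϱ0 hϱ1 τ hτ hCτ hτm hMτ hρw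
    hτ₁ hτ₂ hφτ AQ
  refine ⟨α₁, B, δ, hα₁, hB, hδ, ?_⟩
  intro n η hηL c₀ c₁ _ _ hw hρ m _ hm U αU hα0 hα1 hU1 hreg εU hεU hUε hLb α hα hαle hUst hUb hUη hpl hUgrad hRlev hεg hAQ hpos' hpos η₀ L₀ M₀ R H μ
  refine hasMaj_supSize_of_local₂ (fun y b => mem_boxFine_iff y b) (fun y b => mem_boxFineTgt_iff y b) _ (fun y v => by positivity) ?_
  intro v f F hfv hfF b
  -- the carrier element `e⁻¹ f`, whose values are those of `f`
  set f' : BondL2K ℂ d (towerP L m (n + 1)) c₀ W :=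
    (WL2.linearEquiv ℂ ℂ (fun _ : Bond d (towerP L m (n + 1)) => c₀) :
      BondL2K ℂ d (towerP L m (n + 1)) c₀ W ≃ₗ[ℂ] (Bond d (towerP L m (n + 1)) → W)).symm f with hf'
  have hfv' : ∀ b, blockCoord (L ^ (n + 1)) m (siteCast (towerP_eq_fineP_pow L m (n + 1)) (bpos b)) ≠ UT.toSite m v →
      WL2.equiv ℂ (fun _ : Bond d (towerP L m (n + 1)) => c₀) W f' b = 0 := by
    intro b hb
    have hne : UT.ofSite m (blockCoord (L ^ (n + 1)) m (siteCast (towerP_eq_fineP_pow L m (n + 1)) (bpos b))) ≠ v :=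
      fun h => hb ((ofSite_eq_iff _ _).1 h)
    exact hfv b hne
  have hfF' : ∀ b, ‖WL2.equiv ℂ (fun _ : Bond d (towerP L m (n + 1)) => c₀) W f' b‖ ≤ F := fun b => hfF b
  -- the value of the conjugated operator is that of `D_U(G₁,k f′)_μ`
  have hval : (((WL2.linearEquiv ℂ ℂ (fun _ : Bond d (towerP L m (n + 1)) => c₀) :
            BondL2K ℂ d (towerP L m (n + 1)) c₀ W ≃ₗ[ℂ] (Bond d (towerP L m (n + 1)) → W)).toLinearMap ∘ₗ
          (covDerivL2K ℂ c₀ ((η : ℂ))⁻¹ (adTransportW φ U) ∘ₗ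
            (WL2.linearEquiv ℂ ℂ (fun _ : TSite d (towerP L m (n + 1)) => c₀) :
              SiteL2K ℂ d (towerP L m (n + 1)) c₀ W ≃ₗ[ℂ] (TSite d (towerP L m (n + 1)) → W)).symm.toLinearMap ∘ₗ
            (LinearMap.pi fun y : TSite d (towerP L m (n + 1)) =>
              (LinearMap.proj ((y, μ) : Bond d (towerP L m (n + 1))) : (Bond d (towerP L m (n + 1)) → W) →ₗ[ℂ] W)) ∘ₗ
            (WL2.linearEquiv ℂ ℂ (fun _ : Bond d (towerP L m (n + 1)) => c₀) :
              BondL2K ℂ d (towerP L m (n + 1)) c₀ W ≃ₗ[ℂ] (Bond d (towerP L m (n + 1)) → W)).toLinearMap ∘ₗ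
            G1k L m n φ η U hL αU hα1 hU1 hreg τ (c₀ := c₀) (c₁ := c₁) hpos) ∘ₗ
          (WL2.linearEquiv ℂ ℂ (fun _ : Bond d (towerP L m (n + 1)) => c₀) :
            BondL2K ℂ d (towerP L m (n + 1)) c₀ W ≃ₗ[ℂ] (Bond d (towerP L m (n + 1)) → W)).symm.toLinearMap).restrictScalars ℝ) f b =
        WL2.equiv ℂ (fun _ : Bond d (towerP L m (n + 1)) => c₀) W
          (covDerivL2K ℂ c₀ ((η : ℂ))⁻¹ (adTransportW φ U)
            ((WL2.equiv ℂ (fun _ : TSite d (towerP L m (n + 1)) => c₀) W).symm fun y =>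
              WL2.equiv ℂ (fun _ : Bond d (towerP L m (n + 1)) => c₀) W
                (G1k L m n φ η U hL αU hα1 hU1 hreg τ (c₀ := c₀) (c₁ := c₁) hpos f') (y, μ))) b := rfl
  rw [hval, UT.toSite_ofSite]
  exact (HK n η hηL c₀ c₁ hw hρ m hm U αU hα0 hα1 hU1 hreg εU hεU hUε hLb α hα hαle hUst hUb hUη hpl hUgrad hRlev hεg hAQ hpos' hpos
    (UT.toSite m v) f' F hfv' hfF' μ b).1

end Tower

end Literature.MathematicalPhysics.QuantumFieldTheory.Balaban1983to89.Beta.RemainderHasMajSliceGradG1kTower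

end
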